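import Mathlib
import Summits.NavierStokesRegularity.NavierStokesRegularity.Theorems.EulerZoomLiouvillePowerGaugeEulerLiouvilleSelfSimilarDriftChartTools
import Summits.NavierStokesRegularity.NavierStokesRegularity.Theorems.EulerZoomLiouvillePowerGaugeEulerLiouvilleSelfSimilarDriftChartLemmas
import HarnessLib.Audit

/-!
# Rung C1 of the crux `EulerZoomLiouville.PowerGaugeEulerLiouville`, NO-DRIFT lane (2c/3): the DRIFT CHART at an
# interior point of a transversally non-degenerate arc of zeros — a coordinate `f` with `|Df·W| ≤ K |W|²`

Route №10 `EulerZoomLiouville` (NavierStokesRegularity), crux E = stmt-NavierStokesRegularity-19832, tenure rung C1,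
registered residue `stub_selfSimilarExtremalRest`.  Lineage ns-typeII-p2 (gen 7).  GENERIC CALCULUS on a
finite-dimensional real Hilbert space (no profile, no flow); tools in `…DriftChartTools` (2a/3), `…DriftChartLemmas`
(2b/3); the curve comes from `…SelfSimilarCorankOneZeroCurve` (1/3).

SETTING.  `W : E → E` is `C²`; `c` is a `C¹` curve on `(a, b) ∋ t₀` of zeros of `W` with a continuous left inverse
`τ` and carrying every zero of `W` near `c(t₀)`; `e` is a unit vector and the BORDERED OPERATOR
`T₀ = ⟪e, ·⟫ (c'(t₀) − L e) + L`, `L = DW(c t₀)`, is a linear homeomorphism (the zero `c(t₀)` is transversally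
non-degenerate: `0` is a SIMPLE eigenvalue of `L` with eigenvector `c'(t₀)`).  THE CHART
`Θ(v) = c(⟪e, v⟫) + DW(c ⟪e, v⟫)(v − ⟪e, v⟫ e)` — affine in the fibre variable `h = v − ⟪e,v⟫e` — is a local `C¹`
diffeomorphism at `t₀ e` onto a neighbourhood `D` of `c(t₀)`; `f = ⟪e, Θ⁻¹(·)⟫` (`f(c t) = t`), `g = ‖(Θ⁻¹ ·)_{⊥e}‖`.

THE ESTIMATE (`exists_driftChart`): on the tube `{|f − t₀| < η, g < r}`, **`|Df(y) W(y)| ≤ K ‖W(y)‖²`** — for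
`y = Θ(te + h) = c(t) + L_t h`, Taylor gives `W(y) = L_t L_t h + R`, `‖R‖ ≤ M‖L_t h‖²`, and `Df(y)(L_t L_t h) = 0`
EXACTLY (along the line `s ↦ te + h + s u₀`, `u₀ = L_t h − (⟪e,L_t h⟫/⟪e,c'(t)⟫) c'(t) ⊥ e`, the chart moves by
`s L_t L_t h` while `f ≡ t`), with `‖L_t L_t h‖ ≥ μ‖h‖` near `t₀`; plus compactness of the closed tube, the lateral
boundary staying `d₀` away from the zeros, and zeros in the tube being arc points (for the passage budget in 3/3).

WHAT THIS IS NOT: not NS, not E, not rung C1 — calculus.  [folklore; cf. B. Aulbach, LNM 1058 (1984), Thm 2.3 — the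
«asymptotic phase» statement this geometric input serves; our construction is different and fact-free]
-/

noncomputable section

open Set Filter Metric Function
open scoped Topology RealInnerProductSpace NNReal

-- flat `Theorems/<Route><Decl>…` files of one crux share the namespace of the crux (tree convention)
set_option linter.dupNamespace false

namespace Summit.NavierStokesRegularity.NavierStokesRegularity.Theorems.PowerGaugeEulerLiouville.NoDrift

/-! ### The drift chart -/

section Chart

variable {E : Type*} [NormedAddCommGroup E] [InnerProductSpace ℝ E] [FiniteDimensional ℝ E]

/-- **THE DRIFT CHART.**  `W ∈ C²` on a finite-dimensional real Hilbert space; `c` a `C¹` arc of zeros of `W` on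
`(a, b) ∋ t₀` with a continuous left inverse `τ` and carrying every zero of `W` in `B(c t₀, ρ)`; the bordered operator
`⟪e, ·⟫(c'(t₀) − DW(c t₀) e) + DW(c t₀)` (`‖e‖ = 1`) a linear homeomorphism.  Then there are an open `D ∋ c t₀`,
`f, g` continuous on `D` with `f(c t₀) = t₀`, `g(c t₀) = 0`, and `η, r, K, d₀ > 0` with: (i) the closed tube
`{y ∈ D | |f y − t₀| ≤ η ∧ g y ≤ r}` is compact; (ii) on the open tube `{|f − t₀| < η, g < r}`, `f` is differentiable and
**`|Df(y) W(y)| ≤ K ‖W y‖²`**; (iii) the lateral boundary `{|f − t₀| ≤ η, g = r}` is at distance `≥ d₀` from every zero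
of `W`; (iv) the zeros of `W` in the closed tube are the arc points `c (f z)`, `f z ∈ (a, b)`.  (Mechanism in the
module docstring.) [folklore; cf. Aulbach, LNM 1058 (1984), Thm 2.3] -/
theorem exists_driftChart {W : E → E} (hW : ContDiff ℝ 2 W) {a b t₀ : ℝ} (ht₀ : t₀ ∈ Ioo a b) {c : ℝ → E}
    (hc : ContDiffOn ℝ 1 c (Ioo a b)) (harc : ∀ t ∈ Ioo a b, W (c t) = 0) {e : E} (he : ‖e‖ = 1)
    (T₀ : E ≃L[ℝ] E) (hT₀ : (T₀ : E →L[ℝ] E) =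
      (innerSL ℝ e).smulRight (deriv c t₀ - fderiv ℝ W (c t₀) e) + fderiv ℝ W (c t₀))
    {ρ : ℝ} (hρ : 0 < ρ) (hzero : ∀ y ∈ ball (c t₀) ρ, W y = 0 → ∃ t ∈ Ioo a b, y = c t)
    {τ : E → ℝ} (hτ : Continuous τ) (hτc : ∀ t ∈ Ioo a b, τ (c t) = t) :
    ∃ (D : Set E) (f g : E → ℝ) (η r K d₀ : ℝ), IsOpen D ∧ c t₀ ∈ D ∧ ContinuousOn f D ∧ ContinuousOn g D ∧
      f (c t₀) = t₀ ∧ g (c t₀) = 0 ∧ 0 < η ∧ 0 < r ∧ 0 < K ∧ 0 < d₀ ∧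
      IsCompact {y | y ∈ D ∧ |f y - t₀| ≤ η ∧ g y ≤ r} ∧
      (∀ y ∈ D, |f y - t₀| < η → g y < r →
        DifferentiableAt ℝ f y ∧ |fderiv ℝ f y (W y)| ≤ K * ‖W y‖ ^ 2) ∧
      (∀ y ∈ D, |f y - t₀| ≤ η → g y = r → ∀ z, W z = 0 → d₀ ≤ dist y z) ∧
      (∀ z ∈ D, |f z - t₀| ≤ η → g z ≤ r → W z = 0 → f z ∈ Ioo a b ∧ c (f z) = z) := by
  set L : ℝ → E →L[ℝ] E := fun t => fderiv ℝ W (c t) with hLdef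
  set τ₁ : E → ℝ := fun v => ⟪e, v⟫ with hτ₁
  set P : E → E := fun v => v - (⟪e, v⟫ : ℝ) • e with hPdef
  set Θ : E → E := fun v => c (τ₁ v) + L (τ₁ v) (P v) with hΘdef
  set v₀ : E := t₀ • e with hv₀
  set c'₀ : E := deriv c t₀ with hc'₀
  have hτ₁v₀ : τ₁ v₀ = t₀ := inner_smul_self_unit he t₀
  have hPv₀ : P v₀ = 0 := by simp only [hPdef, hv₀, inner_smul_self_unit he]; exact sub_self _
  have hΘte : ∀ t : ℝ, Θ (t • e) = c t := by
    intro t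
    have h1 : τ₁ (t • e) = t := inner_smul_self_unit he t
    have h2 : P (t • e) = 0 := by simp only [hPdef, inner_smul_self_unit he]; exact sub_self _
    simp only [hΘdef, h1, h2, map_zero, add_zero]
  have hΘv₀ : Θ v₀ = c t₀ := hΘte t₀
  have hdecomp : ∀ v : E, v = (τ₁ v) • e + P v := fun v => by simp [hτ₁, hPdef]
  have hPe : ∀ v : E, (⟪e, P v⟫ : ℝ) = 0 := fun v => inner_proj_eq_zero he v
  have hIoo : IsOpen (Ioo a b) := isOpen_Ioo
  have hcd : ∀ t ∈ Ioo a b, HasDerivAt c (deriv c t) t := fun t ht =>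
    ((hc.differentiableOn (by simp)).differentiableAt (hIoo.mem_nhds ht)).hasDerivAt
  have hdc : ContinuousOn (deriv c) (Ioo a b) := hc.continuousOn_deriv_of_isOpen hIoo le_rfl
  have hDW : ContDiff ℝ 1 (fderiv ℝ W) := hW.fderiv_right (m := 1) le_rfl
  have hWd : Differentiable ℝ W := hW.differentiable (by simp)
  have hLcont : ContinuousOn L (Ioo a b) := hDW.continuous.comp_continuousOn hc.continuousOn
  have hLc' : ∀ t ∈ Ioo a b, L t (deriv c t) = 0 := fun t ht =>
    fderiv_apply_deriv_eq_zero_of_zero_on hWd ht (hcd t ht) harc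
  have hec : (⟪e, c'₀⟫ : ℝ) ≠ 0 := inner_ne_zero_of_bordered he (hLc' t₀ ht₀) T₀ hT₀
  set S : Set E := τ₁ ⁻¹' Ioo a b with hSdef
  have hτ₁c : ContDiff ℝ 1 τ₁ := contDiff_const.inner ℝ contDiff_id
  have hSo : IsOpen S := hIoo.preimage hτ₁c.continuous
  have hv₀S : v₀ ∈ S := by change τ₁ v₀ ∈ Ioo a b; rw [hτ₁v₀]; exact ht₀
  have hPc : ContDiff ℝ 1 P := contDiff_id.sub (hτ₁c.smul contDiff_const)
  obtain ⟨hΘS, hΘ'⟩ : ContDiffOn ℝ 1 Θ S ∧ HasFDerivAt Θ (T₀ : E →L[ℝ] E) v₀ := by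
    rw [hT₀]; exact chart_regularity hW ht₀ hc he
  have hΘ : ContDiffAt ℝ 1 Θ v₀ := hΘS.contDiffAt (hSo.mem_nhds hv₀S)
  have h1ne : (1 : WithTop ℕ∞) ≠ 0 := one_ne_zero
  set G := hΘ.toOpenPartialHomeomorph Θ hΘ' h1ne with hGdef
  have hGcoe : (G : E → E) = Θ := ContDiffAt.toOpenPartialHomeomorph_coe hΘ hΘ' h1ne
  have hv₀s : v₀ ∈ G.source := ContDiffAt.mem_toOpenPartialHomeomorph_source hΘ hΘ' h1ne
  have hct₀t : c t₀ ∈ G.target := by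
    have h := ContDiffAt.image_mem_toOpenPartialHomeomorph_target hΘ hΘ' h1ne
    rwa [hΘv₀] at h
  have hsymm0 : G.symm (c t₀) = v₀ := by
    have h := G.left_inv hv₀s; rwa [hGcoe, hΘv₀] at h
  have hsymmC : ContDiffAt ℝ 1 G.symm (c t₀) := by
    refine G.contDiffAt_symm (f₀' := T₀) hct₀t ?_ ?_
    · rw [hsymm0, hGcoe]; exact hΘ'
    · rw [hsymm0, hGcoe]; exact hΘ
  clear_value G
  obtain ⟨u, hu, hGu⟩ : ∃ u ∈ 𝓝 (c t₀), ContDiffOn ℝ 1 G.symm u := by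
    obtain ⟨u, hu, -, hCu⟩ := hsymmC.contDiffWithinAt.contDiffOn (m := 1) le_rfl (by simp)
    rw [insert_eq_of_mem (mem_univ _), nhdsWithin_univ] at hu
    exact ⟨u, hu, hCu⟩
  obtain ⟨ρ₀, hρ₀, hρ₀sub⟩ : ∃ ρ₀ : ℝ, 0 < ρ₀ ∧ ball (c t₀) ρ₀ ⊆ (u ∩ G.target) ∩ ball (c t₀) ρ := by
    have h : (u ∩ G.target) ∩ ball (c t₀) ρ ∈ 𝓝 (c t₀) :=
      inter_mem (inter_mem hu (G.open_target.mem_nhds hct₀t)) (ball_mem_nhds _ hρ)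
    obtain ⟨ρ₀, hρ₀, h'⟩ := Metric.mem_nhds_iff.1 h
    exact ⟨ρ₀, hρ₀, h'⟩
  have hGs : ContDiffOn ℝ 1 G.symm (ball (c t₀) ρ₀) := hGu.mono fun y hy => (hρ₀sub hy).1.1
  have hGdiff : ∀ y ∈ ball (c t₀) ρ₀, DifferentiableAt ℝ G.symm y := fun y hy =>
    (hGs.differentiableOn (by simp)).differentiableAt (isOpen_ball.mem_nhds hy)
  obtain ⟨Cf, hCf0, hCf⟩ : ∃ Cf : ℝ, 0 ≤ Cf ∧ ∀ y ∈ closedBall (c t₀) (ρ₀ / 2), ‖fderiv ℝ G.symm y‖ ≤ Cf := by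
    have hcont : ContinuousOn (fderiv ℝ G.symm) (ball (c t₀) ρ₀) :=
      hGs.continuousOn_fderiv_of_isOpen isOpen_ball le_rfl
    obtain ⟨C, hC⟩ := (isCompact_closedBall (c t₀) (ρ₀ / 2)).exists_bound_of_continuousOn
      (f := fderiv ℝ G.symm) (hcont.mono (closedBall_subset_ball (by linarith only [hρ₀])))
    exact ⟨max C 0, le_max_right _ _, fun y hy => (hC y hy).trans (le_max_left _ _)⟩
  have hLip : ∀ y ∈ closedBall (c t₀) (ρ₀ / 2), ∀ z ∈ closedBall (c t₀) (ρ₀ / 2),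
      ‖G.symm y - G.symm z‖ ≤ Cf * ‖y - z‖ := fun y hy z hz =>
    (convex_closedBall _ _).norm_image_sub_le_of_norm_fderiv_le
      (fun w hw => hGdiff w (closedBall_subset_ball (by linarith only [hρ₀]) hw)) hCf hz hy
  obtain ⟨M, hM0, hM⟩ := exists_taylor_two_bound hW (c t₀) ρ₀
  obtain ⟨N₀, hN₀⟩ := exists_sqBorderedEquiv he (hLc' t₀ ht₀) T₀ hT₀
  obtain ⟨μ, Λ, η₀, hμ, hΛ, hη₀, hη₀P⟩ := exists_arc_radius ht₀ hLcont hdc hec N₀ hN₀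
  obtain ⟨s₀, hs₀, hs₀sub⟩ : ∃ s₀ : ℝ, 0 < s₀ ∧ ball v₀ s₀ ⊆ G.source :=
    Metric.mem_nhds_iff.1 (G.open_source.mem_nhds hv₀s)
  obtain ⟨ρτ, hρτ, hρτP⟩ : ∃ ρτ : ℝ, 0 < ρτ ∧ ∀ z ∈ ball (c t₀) ρτ, |τ z - t₀| < s₀ := by
    have h : ∀ᶠ z in 𝓝 (c t₀), |τ z - t₀| < s₀ := by
      have h1 : Tendsto (fun z => |τ z - t₀|) (𝓝 (c t₀)) (𝓝 |τ (c t₀) - t₀|) :=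
        ((hτ.continuousAt.sub continuousAt_const).abs).tendsto
      rw [hτc t₀ ht₀, sub_self, abs_zero] at h1
      exact h1.eventually (gt_mem_nhds hs₀)
    obtain ⟨ρτ, hρτ, h'⟩ := Metric.eventually_nhds_iff.1 h
    exact ⟨ρτ, hρτ, fun z hz => h' hz⟩
  set ρ₁ : ℝ := min (ρ₀ / 4) (ρτ / 2) with hρ₁def
  have hρ₁ : 0 < ρ₁ := by rw [hρ₁def]; positivity
  have hρ₁0 : ρ₁ ≤ ρ₀ / 4 := min_le_left _ _
  have hρ₁τ : ρ₁ ≤ ρτ / 2 := min_le_right _ _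
  obtain ⟨s₁, hs₁, hs₁s, hs₁Θ⟩ : ∃ s₁ : ℝ, 0 < s₁ ∧ closedBall v₀ s₁ ⊆ G.source ∧
      ∀ v ∈ closedBall v₀ s₁, Θ v ∈ ball (c t₀) ρ₁ := by
    have h1 : Θ ⁻¹' ball (c t₀) ρ₁ ∈ 𝓝 v₀ := by
      refine hΘ.continuousAt.preimage_mem_nhds ?_
      rw [hΘv₀]; exact ball_mem_nhds _ hρ₁
    obtain ⟨s, hs, hsub⟩ := Metric.mem_nhds_iff.1 (inter_mem (G.open_source.mem_nhds hv₀s) h1)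
    refine ⟨s / 2, half_pos hs, fun v hv => (hsub (closedBall_subset_ball (by linarith only [hs]) hv)).1,
      fun v hv => (hsub (closedBall_subset_ball (by linarith only [hs]) hv)).2⟩
  set η : ℝ := min (η₀ / 2) (s₁ / 2) with hηdef
  set r : ℝ := min (s₁ / 2) (μ / (2 * M * Λ ^ 2 + 2)) with hrdef
  have hη : 0 < η := by rw [hηdef]; positivity
  have hr : 0 < r := by rw [hrdef]; positivity
  have hηη₀ : η < η₀ := lt_of_le_of_lt (min_le_left _ _) (by linarith only [hη₀])
  have hηr : η + r ≤ s₁ := by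
    have h1 := min_le_right (η₀ / 2) (s₁ / 2); have h2 := min_le_left (s₁ / 2) (μ / (2 * M * Λ ^ 2 + 2))
    change η ≤ s₁ / 2 at h1; change r ≤ s₁ / 2 at h2
    linarith only [h1, h2]
  have hrμ : M * Λ ^ 2 * r ≤ μ / 2 := by
    have h1 : r ≤ μ / (2 * M * Λ ^ 2 + 2) := min_le_right _ _
    have h2 : 0 < 2 * M * Λ ^ 2 + 2 := by positivity
    have h3 : M * Λ ^ 2 * (μ / (2 * M * Λ ^ 2 + 2)) ≤ μ / 2 := by
      rw [mul_div_assoc', div_le_div_iff₀ h2 two_pos]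
      nlinarith [hμ.le, hM0, sq_nonneg Λ]
    calc M * Λ ^ 2 * r ≤ M * Λ ^ 2 * (μ / (2 * M * Λ ^ 2 + 2)) :=
          mul_le_mul_of_nonneg_left h1 (by positivity)
      _ ≤ μ / 2 := h3
  set Kbox : Set E := {v | |τ₁ v - t₀| ≤ η ∧ ‖P v‖ ≤ r} with hKboxdef
  have hnormv : ∀ v : E, ‖v - v₀‖ ≤ |τ₁ v - t₀| + ‖P v‖ := by
    intro v
    have h1 : v - v₀ = (τ₁ v - t₀) • e + P v := by
      rw [hv₀]; conv_lhs => rw [hdecomp v]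
      rw [sub_smul]; abel
    rw [h1]
    refine (norm_add_le _ _).trans ?_
    rw [norm_smul, he, mul_one, Real.norm_eq_abs]
  have hKsub : Kbox ⊆ closedBall v₀ s₁ := by
    intro v hv
    rw [mem_closedBall, dist_eq_norm]
    exact (hnormv v).trans (by linarith only [hv.1, hv.2, hηr])
  have hKsource : Kbox ⊆ G.source := hKsub.trans hs₁s
  have hKΘ : ∀ v ∈ Kbox, Θ v ∈ ball (c t₀) ρ₁ := fun v hv => hs₁Θ v (hKsub hv)
  have hKS : Kbox ⊆ S := by
    intro v hv
    have h1 : |τ₁ v - t₀| < η₀ := lt_of_le_of_lt hv.1 hηη₀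
    exact (hη₀P (τ₁ v) h1).1
  have hKcpt : IsCompact Kbox := by
    refine Metric.isCompact_of_isClosed_isBounded ?_ ?_
    · rw [hKboxdef, setOf_and]
      refine (isClosed_le ?_ continuous_const).inter (isClosed_le hPc.continuous.norm continuous_const)
      exact (hτ₁c.continuous.sub continuous_const).abs
    · exact (Metric.isBounded_closedBall (x := v₀) (r := s₁)).subset hKsub
  have hte : ∀ t : ℝ, |t - t₀| ≤ η → t • e ∈ Kbox := by
    intro t ht
    have h1 : τ₁ (t • e) = t := inner_smul_self_unit he t
    have h2 : P (t • e) = 0 := by simp only [hPdef, inner_smul_self_unit he]; exact sub_self _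
    refine ⟨by rw [h1]; exact ht, ?_⟩
    rw [h2, norm_zero]; exact hr.le
  set f : E → ℝ := fun y => τ₁ (G.symm y) with hfdef
  set g : E → ℝ := fun y => ‖P (G.symm y)‖ with hgdef
  have hGsymm_on : ∀ v ∈ G.source, G.symm (Θ v) = v := fun v hv => by
    have h := G.left_inv hv; rwa [hGcoe] at h
  have hΘsymm : ∀ y ∈ G.target, Θ (G.symm y) = y := fun y hy => by
    have h := G.right_inv hy; rwa [hGcoe] at h
  have hsymm_source : ∀ y ∈ G.target, G.symm y ∈ G.source := fun y hy => G.map_target hy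
  have htube_eq : {y | y ∈ G.target ∧ |f y - t₀| ≤ η ∧ g y ≤ r} = Θ '' Kbox := by
    ext y; constructor
    · rintro ⟨hy, h1, h2⟩
      exact ⟨G.symm y, ⟨h1, h2⟩, hΘsymm y hy⟩
    · rintro ⟨v, hv, rfl⟩
      have hvs := hKsource hv
      refine ⟨?_, ?_, ?_⟩
      · have h := G.map_source hvs; rwa [hGcoe] at h
      · change |τ₁ (G.symm (Θ v)) - t₀| ≤ η; rw [hGsymm_on v hvs]; exact hv.1
      · change ‖P (G.symm (Θ v))‖ ≤ r; rw [hGsymm_on v hvs]; exact hv.2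
  have htube_ball : Θ '' Kbox ⊆ ball (c t₀) ρ₁ := by
    rintro y ⟨v, hv, rfl⟩; exact hKΘ v hv
  have hzeros : ∀ z ∈ ball (c t₀) (2 * ρ₁), W z = 0 →
      τ z ∈ Ioo a b ∧ c (τ z) = z ∧ G.symm z = (τ z) • e := by
    intro z hzρ₁ hWz
    have hzρ : z ∈ ball (c t₀) ρ :=
      (hρ₀sub (ball_subset_ball (by linarith only [hρ₁0, hρ₀]) hzρ₁)).2
    obtain ⟨t', ht', hzt'⟩ := hzero z hzρ hWz
    have hτz : τ z = t' := by rw [hzt']; exact hτc t' ht'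
    have hτes : (τ z) • e ∈ G.source := by
      apply hs₀sub
      rw [mem_ball, hv₀, dist_smul_unit he]
      exact hρτP z (ball_subset_ball (by linarith only [hρ₁τ]) hzρ₁)
    refine ⟨hτz ▸ ht', by rw [hτz, ← hzt'], ?_⟩
    have hzΘ : z = Θ ((τ z) • e) := by rw [hΘte, hτz, hzt']
    conv_lhs => rw [hzΘ]
    exact hGsymm_on _ hτes
  refine ⟨G.target, f, g, η, r, Cf * M * (2 * Λ / μ) ^ 2 + 1, min ρ₁ (r / (Cf + 1)), G.open_target, hct₀t,
    ?_, ?_, ?_, ?_, hη, hr, by positivity, by positivity, ?_, ?_, ?_, ?_⟩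
  · exact hτ₁c.continuous.comp_continuousOn G.continuousOn_symm
  · exact (hPc.continuous.norm).comp_continuousOn G.continuousOn_symm
  · change τ₁ (G.symm (c t₀)) = t₀; rw [hsymm0, hτ₁v₀]
  · change ‖P (G.symm (c t₀))‖ = 0; rw [hsymm0, hPv₀, norm_zero]
  · -- compactness of the closed tube
    rw [htube_eq]
    exact hKcpt.image_of_continuousOn (hΘS.continuousOn.mono hKS)
  · -- the drift estimate on the open tube
    intro y hy hfy hgy
    set v : E := G.symm y with hvdef
    have hvs : v ∈ G.source := hsymm_source y hy
    set t : ℝ := τ₁ v with htdef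
    set h : E := P v with hhdef
    have htv : (⟪e, v⟫ : ℝ) = t := rfl
    have hhv : v - (⟪e, v⟫ : ℝ) • e = h := rfl
    have hyv : G.symm y = v := rfl
    have htη : |t - t₀| < η := hfy
    have hhr : ‖h‖ < r := hgy
    have htη₀ : |t - t₀| < η₀ := htη.trans hηη₀
    obtain ⟨htI, hLt, hect, hlow⟩ := hη₀P t htη₀
    have hvK : v ∈ Kbox := ⟨htη.le, hhr.le⟩
    have hteK : t • e ∈ Kbox := hte t htη.le
    have hvdec : v = t • e + h := hdecomp v
    have hhe : (⟪e, h⟫ : ℝ) = 0 := hPe v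
    clear_value h t v
    have hyΘ : y = c t + L t h := by
      have h1 := hΘsymm y hy
      rw [hyv, hvdec] at h1
      rw [← h1]
      have h2 : τ₁ (t • e + h) = t := by
        change (⟪e, t • e + h⟫ : ℝ) = t
        rw [inner_add_right, inner_smul_self_unit he, hhe, add_zero]
      have h3 : P (t • e + h) = h := by
        change (t • e + h) - (⟪e, t • e + h⟫ : ℝ) • e = h
        rw [inner_add_right, inner_smul_self_unit he, hhe, add_zero]; abel
      simp only [hΘdef, h2, h3]
    have hyball : y ∈ ball (c t₀) ρ₁ := by
      have h1 : y = Θ v := by rw [← hyv]; exact (hΘsymm y hy).symm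
      rw [h1]; exact hKΘ v hvK
    have hpball : c t ∈ ball (c t₀) ρ₁ := by have := hKΘ (t • e) hteK; rwa [hΘte] at this
    have hρ₁ρ₀ : ball (c t₀) ρ₁ ⊆ ball (c t₀) ρ₀ := ball_subset_ball (by linarith only [hρ₁0, hρ₀])
    have hWp : W (c t) = 0 := harc t htI
    have hR : ‖W y - L t (L t h)‖ ≤ M * ‖L t h‖ ^ 2 := by
      have h1 := hM (c t) (ball_subset_closedBall (hρ₁ρ₀ hpball)) y (ball_subset_closedBall (hρ₁ρ₀ hyball))
      have h2 : y - c t = L t h := by rw [hyΘ]; abel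
      rwa [hWp, sub_zero, h2] at h1
    have hfdiff : DifferentiableAt ℝ f y :=
      (hτ₁c.differentiable (by simp) _).comp y (hGdiff y (hρ₁ρ₀ hyball))
    have hkey : fderiv ℝ f y (L t (L t h)) = 0 := by
      set u₀ : E := L t h - ((⟪e, L t h⟫ : ℝ) / ⟪e, deriv c t⟫) • deriv c t with hu₀def
      have hu₀e : (⟪e, u₀⟫ : ℝ) = 0 := by
        rw [hu₀def, inner_sub_right, inner_smul_right, div_mul_cancel₀ _ hect, sub_self]
      have hLu₀ : L t u₀ = L t (L t h) := by
        simp only [hu₀def, map_sub, map_smul, hLc' t htI, smul_zero, sub_zero]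
      have hline : ∀ᶠ s in 𝓝 (0 : ℝ), v + s • u₀ ∈ G.source := by
        have h1 : Tendsto (fun s : ℝ => v + s • u₀) (𝓝 0) (𝓝 (v + (0 : ℝ) • u₀)) :=
          ((continuous_const.add (continuous_id.smul continuous_const)).tendsto 0)
        rw [zero_smul, add_zero] at h1
        exact h1 (G.open_source.mem_nhds hvs)
      have hΘline : ∀ s : ℝ, Θ (v + s • u₀) = y + s • L t (L t h) := by
        intro s
        have h1 : τ₁ (v + s • u₀) = t := by
          change (⟪e, v + s • u₀⟫ : ℝ) = t
          rw [inner_add_right, inner_smul_right, hu₀e, mul_zero, add_zero, htv]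
        have h2 : P (v + s • u₀) = h + s • u₀ := by
          have h3 : (⟪e, v + s • u₀⟫ : ℝ) = ⟪e, v⟫ := by
            rw [inner_add_right, inner_smul_right, hu₀e, mul_zero, add_zero]
          change (v + s • u₀) - (⟪e, v + s • u₀⟫ : ℝ) • e = h + s • u₀
          rw [h3, ← hhv]; abel
        calc Θ (v + s • u₀) = c t + L t (h + s • u₀) := by simp only [hΘdef, h1, h2]
          _ = y + s • L t (L t h) := by rw [map_add, map_smul, hLu₀, hyΘ]; abel
      have hconst : ∀ᶠ s in 𝓝 (0 : ℝ), f (y + s • L t (L t h)) = t := by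
        filter_upwards [hline] with s hs
        rw [← hΘline s]
        change τ₁ (G.symm (Θ (v + s • u₀))) = t
        rw [hGsymm_on _ hs]
        change (⟪e, v + s • u₀⟫ : ℝ) = t
        rw [inner_add_right, inner_smul_right, hu₀e, mul_zero, add_zero, htv]
      exact fderiv_apply_eq_zero_of_eventually_const hfdiff hconst
    have hDf : ‖fderiv ℝ f y‖ ≤ Cf := by
      have h1 : HasFDerivAt f ((innerSL ℝ e).comp (fderiv ℝ G.symm y)) y :=
        (hasFDerivAt_inner_left e (G.symm y)).comp y (hGdiff y (hρ₁ρ₀ hyball)).hasFDerivAt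
      rw [h1.fderiv]
      refine (ContinuousLinearMap.opNorm_comp_le _ _).trans ?_
      rw [innerSL_apply_norm, he, one_mul]
      exact hCf y (ball_subset_closedBall ((ball_subset_ball (by linarith only [hρ₁0, hρ₀])) hyball))
    have hk : μ * ‖h‖ ≤ ‖L t (L t h)‖ := hlow h hhe
    have hLh : ‖L t h‖ ≤ Λ * ‖h‖ := ((L t).le_opNorm h).trans (mul_le_mul_of_nonneg_right hLt (norm_nonneg _))
    have hMΛ : 0 ≤ M * Λ ^ 2 := by positivity
    have hsmall : M * Λ ^ 2 * ‖h‖ ≤ μ / 2 := by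
      have h1 : M * Λ ^ 2 * ‖h‖ ≤ M * Λ ^ 2 * r := mul_le_mul_of_nonneg_left hhr.le hMΛ
      exact h1.trans hrμ
    have hkW : ‖L t (L t h)‖ ≤ ‖W y‖ + ‖W y - L t (L t h)‖ := by
      have := norm_sub_le (W y) (W y - L t (L t h))
      rwa [sub_sub_cancel] at this
    have hD : |fderiv ℝ f y (W y)| ≤ Cf * ‖W y - L t (L t h)‖ := by
      have hsplit : fderiv ℝ f y (W y) = fderiv ℝ f y (W y - L t (L t h)) := by
        rw [map_sub, hkey, sub_zero]
      rw [hsplit, ← Real.norm_eq_abs]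
      exact ((fderiv ℝ f y).le_opNorm _).trans (mul_le_mul_of_nonneg_right hDf (norm_nonneg _))
    exact ⟨hfdiff, drift_bound_algebra hμ hΛ hM0 hCf0 (norm_nonneg _) (norm_nonneg _) hk hLh
      hR hsmall hkW hD⟩
  · intro y hy hfy hgy z hz
    by_contra hlt
    rw [not_le] at hlt
    have hyc : y ∈ Θ '' Kbox := by rw [← htube_eq]; exact ⟨hy, hfy, hgy.le⟩
    have hyball : y ∈ ball (c t₀) ρ₁ := htube_ball hyc
    have hd₁ : dist y z < ρ₁ := hlt.trans_le (min_le_left _ _)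
    have hd₂ : dist y z < r / (Cf + 1) := hlt.trans_le (min_le_right _ _)
    have hz2ρ₁ : z ∈ ball (c t₀) (2 * ρ₁) := by
      rw [mem_ball] at hyball ⊢
      calc dist z (c t₀) ≤ dist z y + dist y (c t₀) := dist_triangle _ _ _
        _ < ρ₁ + ρ₁ := by rw [dist_comm]; exact add_lt_add hd₁ hyball
        _ = 2 * ρ₁ := by ring
    obtain ⟨-, -, hGz⟩ := hzeros z hz2ρ₁ hz
    have hy2 : y ∈ closedBall (c t₀) (ρ₀ / 2) := by
      rw [mem_closedBall]; rw [mem_ball] at hyball; linarith only [hyball, hρ₁0, hρ₀]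
    have hz2 : z ∈ closedBall (c t₀) (ρ₀ / 2) := by
      rw [mem_closedBall]; rw [mem_ball] at hyball
      calc dist z (c t₀) ≤ dist z y + dist y (c t₀) := dist_triangle _ _ _
        _ ≤ ρ₁ + ρ₁ := by rw [dist_comm]; exact add_le_add hd₁.le hyball.le
        _ ≤ ρ₀ / 2 := by linarith only [hρ₁0, hρ₀]
    have hL1 := hLip y hy2 z hz2
    rw [hGz] at hL1
    have h1 : r ≤ ‖G.symm y - τ z • e‖ := by
      have h := norm_proj_le he (G.symm y - τ z • e)
      rw [proj_sub_smul he] at h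
      change ‖P (G.symm y)‖ = r at hgy
      rw [← hgy]; exact h
    have h2 : Cf * ‖y - z‖ < r := by
      rw [← dist_eq_norm]
      have h3 : Cf * dist y z ≤ (Cf + 1) * dist y z := mul_le_mul_of_nonneg_right (by linarith only [hCf0]) dist_nonneg
      have h4 : (Cf + 1) * dist y z < r := by
        have := (lt_div_iff₀ (by positivity : (0:ℝ) < Cf + 1)).1 hd₂
        linarith only [this]
      linarith only [h3, h4]
    linarith only [h1, h2, hL1]
  · intro z hz hfz hgz hWz
    have hzc : z ∈ Θ '' Kbox := by rw [← htube_eq]; exact ⟨hz, hfz, hgz⟩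
    have hz2 : z ∈ ball (c t₀) (2 * ρ₁) := ball_subset_ball (by linarith only [hρ₁]) (htube_ball hzc)
    obtain ⟨hI, hcz, hGz⟩ := hzeros z hz2 hWz
    have hfz' : f z = τ z := by
      change τ₁ (G.symm z) = τ z; rw [hGz]; exact inner_smul_self_unit he (τ z)
    rw [hfz']; exact ⟨hI, hcz⟩

end Chart

end Summit.NavierStokesRegularity.NavierStokesRegularity.Theorems.PowerGaugeEulerLiouville.NoDrift

end
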